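import Summits.ResolutionOfSingularities.ResolutionOfSingularities.Theorems.MarkedTransferCampaignW46MohWindowSurfaceHeavyStep
import Summits.ResolutionOfSingularities.ResolutionOfSingularities.Theorems.EquisingularLiftCampaignW45bDeltaMultiplicityEngine
import HarnessLib

/-!
# [OURS · L1 W4.6 rung (iii-2), piece (H)] Surface Moh window — the two readings of the window germ AGREE, and the heavy one-step
# bound in the (H2) regime `regimeMohWindowSurfaceInsep` (cell res-hironaka, LADDER-RESOLUTION rung L, D-0089; unit res-L1-s46-pv-12
# carried by res-D-pv-050; host MarkedTransfer, `--supports stmt-ResolutionOfSingularities-16155 --as helper`; object #1 of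
# res-D-pv-008 AS res-L1-s46-pv-14's census `D/res-D-pv-008/H2-CENSUS.md`)

HONEST FRAMING. Nothing here is a statement of H. Hironaka's manuscript [Hironaka2017] and nothing here asserts that any statement
of it holds. THEOREMS about res-L1-type-o1's OURS predicates (`…W46MohWindowSurface.lean`): §1 proves the «prover's remark» left
open in the docstring of `MohWindowSurfaceCoeffAt` — in a regular local ring of embedding dimension `3` the IDEAL-POWER reading
`MohWindowSurfaceAt` (`J = (z^b + f)`, `f ∈ (x, y)^d ∖ 𝔪^{d+1}`) and the COEFFICIENT reading `MohWindowSurfaceCoeffAt`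
(`J = (z^b + Σ_{k ≤ d} a_k x^{d−k} y^k)`, a unit among the `a_k`) are EQUIVALENT (monomial presentation of `(x, y)^d`, tree
`exists_polynomial_of_mem_span_pair_pow`; quasi-regularity `coeffForm_not_mem_pow_succ`), hence the regimes
`regimeMohWindowSurfaceInsep` (§2 of o1's file, the regime of the general rungs `MohWindowSurfaceInsep…` and of res-D-pv-008's
growth witness) and `Regime.mohWindowSurface` (§5) COINCIDE; §2 carries the heavy one-step bound of `…HeavyStep.lean` to
`regimeMohWindowSurfaceInsep`: for a blow-up of a §2.1-permissible centre with source and transform in the regime,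
`residualOrder(ξ′) + p ≤ 2 · residualOrder(π ξ′)` at every singular `ξ′` over the centre — the regime and the residual-order
normal form in which res-D-pv-008's `MohWindowSurfaceGrowth.exists_growth_step_residualOrder` (`p + 1 ↦ p + 2`) shows the bound
is ATTAINED. AI-written; AI review is weaker than expert review. No `sorry`; axioms standard. [folklore]
-/

noncomputable section

set_option linter.dupNamespace false -- mandated namespace of this single-conjunct summit

open CategoryTheory AlgebraicGeometry TopologicalSpace IsLocalRing

namespace Summit.ResolutionOfSingularities.ResolutionOfSingularities.Theorems

namespace CampaignW46

open Literature.AlgebraicGeometry.Resolution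
open Literature.AlgebraicGeometry.Hironaka2017.S02Preliminaries
open Literature.AlgebraicGeometry.Hironaka2017.Datum
open Literature.AlgebraicGeometry.Hironaka2017.S16Proof
open Scheme.IdealSheafData
open Polynomial
open Summit.ResolutionOfSingularities.ResolutionOfSingularities.Cruxes.EquisingularLiftNat.Sections
  (exists_polynomial_of_mem_span_pair_pow)

universe u

/-! ## 1. The ideal-power and the coefficient readings of the window germ agree -/

/-- **Ideal-power reading ⇒ coefficient reading.** If `J = (z^b + f)` with `f ∈ (x, y)^d`, `f ∉ 𝔪^{d+1}` for a regular system of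
parameters `(x, y, z)`, then `f = Σ_{k ≤ d} a_k x^{d−k} y^k` with a UNIT among the `a_k` (monomial presentation of `(x, y)^d`; were all
`a_k ∈ 𝔪`, `f ∈ 𝔪^{d+1}`). Any local ring. NOT a statement of the manuscript. [folklore] -/
theorem MohWindowSurfaceAt.coeffAt {b : ℕ} {R : Type u} [CommRing R] [IsLocalRing R] {I : Ideal R}
    (h : MohWindowSurfaceAt b R I) : MohWindowSurfaceCoeffAt b R I := by
  obtain ⟨hR, h3, x, y, z, hxyz, d, f, hbd, hd2, hf, hfnot, hI⟩ := h
  -- monomial presentation of `(x, y)^d = (y, x)^d`: `f = Σ_j q_j y^j x^{d-j}`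
  have hf' : f ∈ Ideal.span {y, x} ^ d := by rwa [Set.pair_comm] at hf
  obtain ⟨q, -, hfq⟩ := exists_polynomial_of_mem_span_pair_pow y x d hf'
  have hfeq : f = ∑ j ∈ Finset.range (d + 1), q.coeff j * x ^ (d - j) * y ^ j := by
    rw [hfq]; exact Finset.sum_congr rfl fun j _ => by ring
  refine ⟨hR, h3, x, y, z, hxyz, d, fun j => q.coeff j, hbd, hd2, ?_, by rw [hI, hfeq]⟩
  -- a unit coefficient: otherwise every term lies in `𝔪^{d+1}`
  by_contra hno'
  have hno : ∀ j ≤ d, ¬ IsUnit (q.coeff j) := fun j hj hu => hno' ⟨j, hj, hu⟩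
  apply hfnot
  rw [hfeq]
  refine Ideal.sum_mem _ fun j hj => ?_
  have hjd : j ≤ d := Nat.lt_succ_iff.mp (Finset.mem_range.mp hj)
  have hqj : q.coeff j ∈ maximalIdeal R := (mem_maximalIdeal _).mpr (mem_nonunits_iff.mpr (hno j hjd))
  have hx : x ∈ maximalIdeal R := hxyz ▸ Ideal.subset_span (Set.mem_insert _ _)
  have hy : y ∈ maximalIdeal R := hxyz ▸ Ideal.subset_span (Set.mem_insert_of_mem _ (Set.mem_insert _ _))
  have h1 : q.coeff j * x ^ (d - j) * y ^ j ∈ maximalIdeal R ^ (1 + (d - j) + j) := by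
    rw [pow_add, pow_add, pow_one]
    exact Ideal.mul_mem_mul (Ideal.mul_mem_mul hqj (Ideal.pow_mem_pow hx _)) (Ideal.pow_mem_pow hy _)
  have h2 : 1 + (d - j) + j = d + 1 := by omega
  rwa [h2] at h1

/-- **Coefficient reading ⇒ ideal-power reading**: `Σ a_k x^{d−k} y^k ∈ (x, y)^d` (`coeffForm_mem_span_pow`) and, with a unit
coefficient, `∉ 𝔪^{d+1}` by quasi-regularity of the regular system of parameters (`coeffForm_not_mem_pow_succ`). NOT a statement of
the manuscript. [folklore] -/
theorem MohWindowSurfaceCoeffAt.windowAt {b : ℕ} {R : Type u} [CommRing R] [IsLocalRing R] {I : Ideal R}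
    (h : MohWindowSurfaceCoeffAt b R I) : MohWindowSurfaceAt b R I := by
  obtain ⟨hR, h3, x, y, z, hxyz, d, a, hbd, hd2, hunit, hI⟩ := h
  exact ⟨hR, h3, x, y, z, hxyz, d, _, hbd, hd2, MohWindowSurface.coeffForm_mem_span_pow x y d a,
    MohWindowSurface.coeffForm_not_mem_pow_succ hR h3 hxyz hunit, hI⟩

/-- **The two readings are equivalent.** NOT a statement of the manuscript. [folklore] -/
theorem mohWindowSurfaceAt_iff_coeffAt {b : ℕ} {R : Type u} [CommRing R] [IsLocalRing R] {I : Ideal R} :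
    MohWindowSurfaceAt b R I ↔ MohWindowSurfaceCoeffAt b R I :=
  ⟨MohWindowSurfaceAt.coeffAt, MohWindowSurfaceCoeffAt.windowAt⟩

variable {p : ℕ} [Fact p.Prime] {K : Type u} [Field K] [CharP K p]

/-- **The regimes coincide**: o1's §2 regime `regimeMohWindowSurfaceInsep` (isolated singular locus, ideal-power window germ,
`E.b = p`) IS the §5 regime `Regime.mohWindowSurface` (coefficient presentation). NOT a statement of the manuscript. [folklore] -/
theorem regimeMohWindowSurfaceInsep_iff_mohWindowSurface (A : AmbientDatum p K) (E : IdealExponent A.Z) :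
    regimeMohWindowSurfaceInsep (p := p) (K := K) A E ↔ Regime.mohWindowSurface A E := by
  rw [regimeMohWindowSurfaceInsep_iff, Regime.mohWindowSurfaceIsolated_iff]
  constructor
  · rintro ⟨⟨⟨hfin, hcl⟩, hwin⟩, hb⟩
    exact ⟨hb, hfin, hcl, fun ξ hξ => (hwin ξ hξ).coeffAt⟩
  · rintro ⟨hb, hfin, hcl, hwin⟩
    exact ⟨⟨⟨hfin, hcl⟩, fun ξ hξ => (hwin ξ hξ).windowAt⟩, hb⟩

/-! ## 2. The heavy one-step bound in `regimeMohWindowSurfaceInsep` -/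

namespace MohWindowSurfaceHeavy

variable {A A' : AmbientDatum p K} {E : IdealExponent A.Z}

/-- **[OURS · L1 W4.6 rung (iii-2), piece (H)] THE HEAVY ONE-STEP BOUND in the (H2) regime.** For the blow-up `π` of a
§2.1-permissible centre `D` with source `(A, E)` and transform `(A′, E.transform π D)` both in `regimeMohWindowSurfaceInsep`
(purely inseparable surface window `z^p + f`, `p < ord f < 2p`, isolated singular locus — NO tameness), at every singular point `ξ′`
of the transform over the centre `residualOrder(ξ′) + p ≤ 2 · residualOrder(π ξ′)`: the excess `ord f − p` AT MOST DOUBLES.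
ATTAINED: res-D-pv-008's `MohWindowSurfaceGrowth.exists_growth_step_residualOrder` (`p ≥ 3`, `K` perfect: residual order `p + 1` at
the centre, `p + 2` at every singular point upstairs). NOT a statement of the manuscript. [folklore] -/
theorem residualOrder_le_of_over_centre_insep {D : Closeds A.Z} (π : A'.Z ⟶ A.Z) (hπ : IsBlowup π (vanishingIdeal D))
    (hD : E.IsPermissibleCentre A.hom D) (hRg : regimeMohWindowSurfaceInsep (p := p) (K := K) A E)
    (hRg' : regimeMohWindowSurfaceInsep (p := p) (K := K) A' (E.transform π D)) {x' : A'.Z}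
    (hx' : x' ∈ (E.transform π D).sing) (hover : π.base x' ∈ (D : Set A.Z)) :
    (residualOrder (E.transform π D).b (A'.Z.presheaf.stalk x') (stalkIdeal (E.transform π D).J x')).toNat + p ≤
      2 * (residualOrder E.b (A.Z.presheaf.stalk (π.base x')) (stalkIdeal E.J (π.base x'))).toNat :=
  residualOrder_le_of_over_centre π hπ hD ((regimeMohWindowSurfaceInsep_iff_mohWindowSurface A E).mp hRg)
    ((regimeMohWindowSurfaceInsep_iff_mohWindowSurface A' _).mp hRg') hx' hover

/-- **Over the centre every singular point upstairs has residual order `< 3p`** (`d′ ≤ 2d − p < 3p` since `d < 2p`) — vacuous as a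
window bound (`d′ < 2p` holds in the regime anyway) but recorded as the form in which the bound composes along runs: after `n`
blow-ups staying in the regime the excess is `≤ 2^n · (d₀ − p)`. NOT a statement of the manuscript. [folklore] -/
theorem residualOrder_transform_lt {D : Closeds A.Z} (π : A'.Z ⟶ A.Z) (hπ : IsBlowup π (vanishingIdeal D))
    (hD : E.IsPermissibleCentre A.hom D) (hRg : regimeMohWindowSurfaceInsep (p := p) (K := K) A E)
    (hRg' : regimeMohWindowSurfaceInsep (p := p) (K := K) A' (E.transform π D)) {x' : A'.Z}
    (hx' : x' ∈ (E.transform π D).sing) (hover : π.base x' ∈ (D : Set A.Z)) {d : ℕ}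
    (hd : (residualOrder E.b (A.Z.presheaf.stalk (π.base x')) (stalkIdeal E.J (π.base x'))).toNat ≤ d) :
    (residualOrder (E.transform π D).b (A'.Z.presheaf.stalk x') (stalkIdeal (E.transform π D).J x')).toNat + p ≤ 2 * d := by
  have h := residualOrder_le_of_over_centre_insep π hπ hD hRg hRg' hx' hover
  omega

end MohWindowSurfaceHeavy

end CampaignW46

end Summit.ResolutionOfSingularities.ResolutionOfSingularities.Theorems

end
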